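import Mathlib
import HarnessLib
import Summits.HubbardSuperconductivity.HubbardSuperconductivity.Theorems.KLProgrammeKLRegimeSplitSymInterpExact
import Summits.HubbardSuperconductivity.HubbardSuperconductivity.Theorems.KLProgrammeKLRegimeSplitTwoLegCounterVertex
import Summits.HubbardSuperconductivity.HubbardSuperconductivity.Theorems.KLProgrammeKLRegimeSplitTwoLegFrameLipschitzIncrement

/-!
# Route `KLProgramme` — ENGINE child 19918, two-leg slot at scale `0`: the (E3c) RESPONSE reading for BAND-LIMITED frames from ONE position-space
# response modulus of `G'_K − G'_{K'}`, `G'_K := 𝒱^{(0)}_K − 𝒩_K`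

Cell `gate-hubbard-kl`, seat p1b (g7).  The scale-0 (E3c) closers (`frameLipschitzFnT_zero_of_responses_explicit`, `twoLegCoreT_zero_of_exports_sep[_stub5]`)
take the TWO-FRAME RESPONSE of the K-subtracted reading function as a hypothesis:
`|(S₀ᴷ − K)(p) − (S₀^{K'} − K')(p)| ≤ ρ₀·frameDist K K'` at the points `p = k_F^{K'}(θ)`.  For BAND-LIMITED frames (`…SymInterpExact` §4 — the
formal shape of repair (R-deg) of memo SCALE0-TWOLEG-EXPORTS.md; every `symInterp L` output is band-limited) the frame part of this reading cancels
EXACTLY (`eval_symInterp_latticeValues_of_bandLimited`: `S₀ᴷ − K = I_L(loc G'_K)`), so the response is a genuine MODEL response, read like the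
n ≥ 1 responses (`abs_increment_eval_sub_le_of_position_moment`) from the pinned zeroth position moment of the unsectorised two-leg kernels of
`G'_K − G'_{K'} = (𝒱_K^{(0)} − 𝒩_K) − (𝒱_{K'}^{(0)} − 𝒩_{K'})`:

* **`abs_scaleZero_response_le_of_position_modulus`** — for band-limited `K, K'` and every `p`:
  `|(S₀ᴷ − K)(p) − (S₀^{K'} − K')(p)| ≤ 2·Mᴿ` whenever `ε_x Σ_{x : x 0 = x₀} ‖W_σ(G'_K − G'_{K'})(x)‖ ≤ Mᴿ` (both spin strings);
* **`scaleZero_response_hr₀_of_position_modulus`** — hence the `hr₀` hypothesis of the scale-0 (E3c) closers in the shape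
  `… ≤ (2ρ)·frameDist K K'` from a modulus `Mᴿ = ρ·frameDist K K'`, for the band-limited comparison frames.

(For a NON-band-limited comparison frame the clause as typed is the subject of finding F2 — no supplier is offered there.)  Proofs only; nothing
about the model is asserted.  References: BGM 2006 §2.4 [cite: BenfattoGiulianiMastropietro2006].
-/

noncomputable section

namespace Summit.HubbardSuperconductivity.HubbardSuperconductivity.Theorems.TwoLegFourier

set_option linter.dupNamespace false -- summit = problem name (single-conjunct summit), D-0017

open Finset Complex
open Literature.MathematicalPhysics.QuantumLattice Literature.Probability.LatticeModels GrassmannAlgebra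
open Summit.HubbardSuperconductivity.HubbardSuperconductivity.Theorems.KLRegimeSplit
open Summit.HubbardSuperconductivity.HubbardSuperconductivity.Theorems.KLProgrammeLegKernels

variable {L M : ℕ} [NeZero L] [NeZero M]

/-- **The scale-0 two-frame response of the K-subtracted reading, band-limited frames, from ONE position-space modulus**:
`|(S₀ᴷ − K)(p) − (S₀^{K'} − K')(p)| ≤ 2·Mᴿ` with `Mᴿ` the pinned zeroth moment of the two-leg kernels of `(𝒱⁽⁰⁾_K − 𝒩_K) − (𝒱⁽⁰⁾_{K'} − 𝒩_{K'})`. -/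
theorem abs_scaleZero_response_le_of_position_modulus {β : ℝ} (hβ : 0 < β) (U μ : ℝ) (K K' : TrigPolyC4v)
    (hband : ∀ m n, m ≤ K.degree → n ≤ K.degree → (L / 2 < m ∨ L / 2 < n) → K.coeff m n = 0)
    (hband' : ∀ m n, m ≤ K'.degree → n ≤ K'.degree → (L / 2 < m ∨ L / 2 < n) → K'.coeff m n = 0) {MR : ℝ}
    (hMR : ∀ (σ : Fin 2) (x₀ : SpaceTimeIdx L M), imagTimeWeight β M *
      ∑ x ∈ (univ : Finset (Fin 2 → SpaceTimeIdx L M)).filter (fun x => x 0 = x₀),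
        (1 + ((((x 1).2 - (x 0).2) 0).valMinAbs.natAbs : ℝ) + ((((x 1).2 - (x 0).2) 1).valMinAbs.natAbs : ℝ)) ^ 0 *
          ‖sectorisedKernel L M β (trivialMultiplier L M)
              ((klEffectiveAction L M β U μ K klE0 0 - counterQuadratic L M β K) -
                (klEffectiveAction L M β U μ K' klE0 0 - counterQuadratic L M β K')) 2
              (![((0, σ), 0), ((0, σ), 1)] : Fin 2 → SectorLeg 1) x‖ ≤ MR) (p : Fin 2 → ℝ) :
    |((symInterp L (klLocSelfEnergyRe L M β U μ K 0)).eval p - K.eval p) -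
        ((symInterp L (klLocSelfEnergyRe L M β U μ K' 0)).eval p - K'.eval p)| ≤ 2 * MR := by
  set G₁ := klEffectiveAction L M β U μ K klE0 0 - counterQuadratic L M β K with hG₁
  set G₀ := klEffectiveAction L M β U μ K' klE0 0 - counterQuadratic L M β K' with hG₀
  have hmom := sum_weight_abs_torusCosCoeff_locAvg_sub_le (L := L) (M := M) hβ G₁ G₀ 0 hMR
  -- the K-subtracted readings are the interpolants of the K-separated data (band-limited frames: no aliasing)
  have hread : ∀ (X : TrigPolyC4v), (∀ m n, m ≤ X.degree → n ≤ X.degree → (L / 2 < m ∨ L / 2 < n) → X.coeff m n = 0) →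
      (symInterp L (klLocSelfEnergyRe L M β U μ X 0)).eval p - X.eval p =
        (symInterp L (fun k => klLocSelfEnergyRe L M β U μ X 0 k - X.eval (latticeMomentum L k))).eval p := by
    intro X hX
    rw [eval_symInterp_sub L (klLocSelfEnergyRe L M β U μ X 0) (fun k => X.eval (latticeMomentum L k)),
      eval_symInterp_latticeValues_of_bandLimited L X hX]
  rw [hread K hband, hread K' hband']
  -- identify the data with the localised data of `G₁`, `G₀`
  have hdata : (fun k : TorusSite 2 L =>
      (∑ σ : Fin 2, ((selfEnergy L M β G₁ (omega0 M, k) σ).re + (selfEnergy L M β G₁ ((omega0 M).rev, k) σ).re)) / 4 -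
      (∑ σ : Fin 2, ((selfEnergy L M β G₀ (omega0 M, k) σ).re + (selfEnergy L M β G₀ ((omega0 M).rev, k) σ).re)) / 4) =
      fun k => (klLocSelfEnergyRe L M β U μ K 0 k - K.eval (latticeMomentum L k)) -
        (klLocSelfEnergyRe L M β U μ K' 0 k - K'.eval (latticeMomentum L k)) := by
    funext k
    rw [hG₁, hG₀, klLocSelfEnergyRe_sub_frame_eq_locRe hβ.ne' U μ K 0 k, klLocSelfEnergyRe_sub_frame_eq_locRe hβ.ne' U μ K' 0 k]
  rw [hdata] at hmom
  have hev : (symInterp L fun k => klLocSelfEnergyRe L M β U μ K 0 k - K.eval (latticeMomentum L k)).eval p -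
      (symInterp L fun k => klLocSelfEnergyRe L M β U μ K' 0 k - K'.eval (latticeMomentum L k)).eval p =
      evalM (symInterp L fun k => (klLocSelfEnergyRe L M β U μ K 0 k - K.eval (latticeMomentum L k)) -
        (klLocSelfEnergyRe L M β U μ K' 0 k - K'.eval (latticeMomentum L k))) (WithLp.toLp 2 p) := by
    simp only [evalM_apply]
    rw [eval_symInterp_sub L (fun k => klLocSelfEnergyRe L M β U μ K 0 k - K.eval (latticeMomentum L k))
      (fun k => klLocSelfEnergyRe L M β U μ K' 0 k - K'.eval (latticeMomentum L k))]
  rw [hev, ← Real.norm_eq_abs, ← norm_iteratedFDeriv_zero (𝕜 := ℝ)]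
  exact (norm_iteratedFDeriv_evalM_le_coeffNorm _ 0 _).trans ((coeffNorm_symInterp_le _ 0).trans hmom)

/-- **The `hr₀` hypothesis of the scale-0 (E3c) closers for a band-limited comparison frame**: if the response kernels have pinned zeroth moment
`≤ ρ·frameDist K K'`, then `|(S₀ᴷ − K)(k_F^{K'}θ) − (S₀^{K'} − K')(k_F^{K'}θ)| ≤ (2ρ)·frameDist K K'` at every `θ`. -/
theorem scaleZero_response_hr₀_of_position_modulus {β : ℝ} (hβ : 0 < β) (U μ : ℝ) (K K' : TrigPolyC4v)
    (hband : ∀ m n, m ≤ K.degree → n ≤ K.degree → (L / 2 < m ∨ L / 2 < n) → K.coeff m n = 0)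
    (hband' : ∀ m n, m ≤ K'.degree → n ≤ K'.degree → (L / 2 < m ∨ L / 2 < n) → K'.coeff m n = 0) {ρ : ℝ}
    (hρ : ∀ (σ : Fin 2) (x₀ : SpaceTimeIdx L M), imagTimeWeight β M *
      ∑ x ∈ (univ : Finset (Fin 2 → SpaceTimeIdx L M)).filter (fun x => x 0 = x₀),
        (1 + ((((x 1).2 - (x 0).2) 0).valMinAbs.natAbs : ℝ) + ((((x 1).2 - (x 0).2) 1).valMinAbs.natAbs : ℝ)) ^ 0 *
          ‖sectorisedKernel L M β (trivialMultiplier L M)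
              ((klEffectiveAction L M β U μ K klE0 0 - counterQuadratic L M β K) -
                (klEffectiveAction L M β U μ K' klE0 0 - counterQuadratic L M β K')) 2
              (![((0, σ), 0), ((0, σ), 1)] : Fin 2 → SectorLeg 1) x‖ ≤ ρ * frameDist K K') (θ : ℝ) :
    |((symInterp L (klLocSelfEnergyRe L M β U μ K 0)).eval (klFermiPoint μ K' θ) - K.eval (klFermiPoint μ K' θ)) -
        ((symInterp L (klLocSelfEnergyRe L M β U μ K' 0)).eval (klFermiPoint μ K' θ) - K'.eval (klFermiPoint μ K' θ))| ≤
      2 * ρ * frameDist K K' := by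
  have h := abs_scaleZero_response_le_of_position_modulus (L := L) (M := M) hβ U μ K K' hband hband' hρ (klFermiPoint μ K' θ)
  linarith

end Summit.HubbardSuperconductivity.HubbardSuperconductivity.Theorems.TwoLegFourier

end
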